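import Summits.HubbardSuperconductivity.HubbardSuperconductivity.Theorems.WeakCouplingBCSKlLindhardEnclosureKernel

/-!
# KL-MARGIN-SCAN reader idea-4 (lens «cascade»), round 11 «kernel-lindhard-enclosure» — CORE part 4/4: §4 the two named soundness statements `FloorSoundAt`/`CeilSoundAt` (typed, UNPROVED, prover-owned) and the gate theorems proved from them · §5 analytic anchors of the ceiling rules (proved)

Part 4/4 of `r11/Core.lean` (sha16 2ed93ab82e33da2d; crux idea on `stmt-HubbardSuperconductivity-0158`; author hubbard-klscan-idea-4 g11; graded by
hubbard-klscan-crit-1 g3): the 1 110-line Core is split into four modules because the gate caps a Theorems file with proofs at 400 lines; content VERBATIM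
(packaging: gate-hubbard-kl-p1 g24).  Enclosures/confirmations hold MODULO the typed, unproved `FloorSoundAt`/`CeilSoundAt`; floats are floats; nothing
here asserts a KL margin at any `t′ ≠ 0`, `K₃`, `U₀`, the window or B1g dominance; a Kohn–Luttinger instability statement is not ODLRO and nothing in this
file proves superconductivity in the Hubbard model.
-/

noncomputable section

set_option linter.dupNamespace false

namespace Summit.HubbardSuperconductivity.HubbardSuperconductivity.Theorems.KlLindhardEnclosure

open Real Set MeasureTheory Literature.MathematicalPhysics.QuantumLattice
open Summit.HubbardSuperconductivity.HubbardSuperconductivity.Theorems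
open Summit.HubbardSuperconductivity.HubbardSuperconductivity.Theorems.FSPoly (cosTaylorQ cosLoQ cosUpQ piLoQ cosLoQ_le_cos
  cos_le_cosUpQ cast_cosTaylorQ)
open Summit.HubbardSuperconductivity.HubbardSuperconductivity.Theorems.KlStair (bandQ bandR piUpQ cast_bandQ
  squareDispersion_eq_bandR pi_lt_piUpQ)

/-! ## §4 The real-analysis side: the two named statements and the gate theorems proved from them -/

/-- The transfer momentum `q` as a point of `Momentum`. [folklore] -/
def Params.qv (P : Params) : Momentum := WithLp.toLp 2 ![((P.q1 : ℚ) : ℝ), ((P.q2 : ℚ) : ℝ)]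

/-- The band `ε_{t′} = squareDispersion 1 t′`. [folklore] -/
def Params.band (P : Params) : Momentum → ℝ := squareDispersion 1 ((P.tp : ℚ) : ℝ)

/-- The two-shell Lindhard integrand of the certificate's `(t′, μ, q)`. [folklore] -/
def Params.integrand (P : Params) : Momentum → ℝ := lindhardIntegrand P.band ((P.mu : ℚ) : ℝ) P.qv

/-- The Lindhard function `χ₀(q; μ, t′)` of the certificate's parameters. [folklore] -/
def Params.chi (P : Params) : ℝ := lindhardFunction P.band ((P.mu : ℚ) : ℝ) P.qv

/-- The grid cell `[z0/U, z1/U) × [w0/U, w1/U)` as a half-open box of momentum space. [folklore] -/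
def Params.cellSet (P : Params) (z0 z1 w0 w1 : ℤ) : Set Momentum :=
  {p | ((P.toQ z0 : ℚ) : ℝ) ≤ p 0 ∧ p 0 < ((P.toQ z1 : ℚ) : ℝ) ∧ ((P.toQ w0 : ℚ) : ℝ) ≤ p 1 ∧ p 1 < ((P.toQ w1 : ℚ) : ℝ)}

/-- **FLOOR SOUNDNESS at `(P, t)`** (prover-owned predicate, the round-10 statement cell by cell): for admissible `P`, if the two-shell
integrand is integrable on the zone then the floor numerator is at most `2^30 ∫_BZ F`. Ingredients as in round 10 (`flZ_le/le_clZ`,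
floor-division inequalities, cosine range lemmas, `KlStair.bandR_anti_left/right`, `lindhardIntegrand_eq_ite_inv`, Jensen + interpolation,
the cosine-coordinate substitution with `band_lt_iff_bStar_lt`/`mu_sub_band_eq`, `logLo ≤ log`, additivity over disjoint half-open boxes,
floor cells `⊆ [−piLoZ, piLoZ)² ⊆ BZ`, `F ≥ 0` elsewhere). [folklore] -/
def FloorSoundAt (P : Params) (t : QB) : Prop :=
  P.admissible = true → IntegrableOn P.integrand brillouinZone volume →
    (((P.rootEval t).1 : ℤ) : ℝ) ≤ 2 ^ 30 * ∫ p in brillouinZone, P.integrand p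

/-- **CEILING SOUNDNESS at `(P, t)`** (prover-owned predicate, the new statement): for admissible `P`, if the kernel certifies a ceiling
numerator `N` then the two-shell integrand is integrable on the zone AND `2^30 ∫_BZ F ≤ N`. Ingredients: the root square covers
`[−π, π)²` (`piUpZ ≤ Xz`) and `F ≥ 0` (`lindhardIntegrand_nonneg`), so `∫_BZ ≤ Σ_leaves ∫_cell`; per leaf `lindhardIntegrand_le_inv` and:
same-side cells `F = 0`; chord rule for convex `1/x` with `avg g ≥ (Σ corner lower values − E)/4D`; crude `F ≤ D/L`; the majorised hyperbola
(§1 `logUpZ` majorant = §5 `log_le_pade` + dyadic reduction, `S ↦ log(1+SL/V)/S` antitone, Jacobian `≥ τ` from `sinLoOK`, crescent extent from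
the monotone `b⋆`); the TIP RULE (§5 `tip_slice_ineq`, the mean-value matrix bound `|Āv|₁ ≥ (J₀/L)|v|_∞`, `∫₀^T log(1+A/t) ≤ T log(1+A/T) + T`);
finiteness of every certified leaf bound gives `∫⁻ F < ∞` on the cover, whence integrability (measurability from
`KohnLuttingerLindhardMeasurable`). [folklore] -/
def CeilSoundAt (P : Params) (t : QB) : Prop :=
  ∀ N : ℤ, P.admissible = true → (P.rootEval t).2 = some N →
    IntegrableOn P.integrand brillouinZone volume ∧ 2 ^ 30 * ∫ p in brillouinZone, P.integrand p ≤ (N : ℝ)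

/-- `(2π)² ≤ (2·piUpQ)²`. [folklore] -/
theorem twoPi_sq_le : (2 * π) ^ 2 ≤ (2 * ((piUpQ : ℚ) : ℝ)) ^ 2 := by
  have := pi_lt_piUpQ
  have h0 : 0 ≤ 2 * π := by positivity
  exact pow_le_pow_left₀ h0 (by linarith) 2

/-- `(2·piLoQ)² ≤ (2π)²`. [folklore] -/
theorem le_twoPi_sq : (2 * ((piLoQ : ℚ) : ℝ)) ^ 2 ≤ (2 * π) ^ 2 := by
  have hlo : ((piLoQ : ℚ) : ℝ) < π := by rw [FSPoly.piLoQ]; push_cast; linarith [Real.pi_gt_d6]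
  have h0 : (0 : ℝ) ≤ 2 * ((piLoQ : ℚ) : ℝ) := by rw [FSPoly.piLoQ]; push_cast; norm_num
  exact pow_le_pow_left₀ h0 (by linarith) 2

/-- `0 < (2·piLoQ)²`. [folklore] -/
theorem twoPiLo_sq_pos : (0 : ℝ) < (2 * ((piLoQ : ℚ) : ℝ)) ^ 2 := by
  rw [FSPoly.piLoQ]; push_cast; norm_num

/-- FLOOR GATE: from `FloorSoundAt`, `N_floor / (2^30 (2·piUpQ)²) ≤ χ₀` when the integrand is integrable. [folklore] -/
theorem floor_le_lindhard (P : Params) (t : QB) (hS : FloorSoundAt P t) (hP : P.admissible = true)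
    (hint : IntegrableOn P.integrand brillouinZone volume) :
    (((P.rootEval t).1 : ℤ) : ℝ) / (2 ^ 30 * (2 * ((piUpQ : ℚ) : ℝ)) ^ 2) ≤ P.chi := by
  have h := hS hP hint
  have hpi := twoPi_sq_le
  have hI : (((P.rootEval t).1 : ℤ) : ℝ) / 2 ^ 30 ≤ ∫ p in brillouinZone, P.integrand p := by
    rw [div_le_iff₀ (by positivity)]; linarith
  unfold Params.chi lindhardFunction
  have hpos : (0 : ℝ) < (2 * π) ^ 2 := by positivity
  by_cases hN : (((P.rootEval t).1 : ℤ) : ℝ) ≤ 0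
  · have hχ : 0 ≤ (∫ p in brillouinZone, P.integrand p) / (2 * π) ^ 2 :=
      div_nonneg (integral_nonneg fun p => lindhardIntegrand_nonneg _ _ _ p) hpos.le
    exact le_trans (div_nonpos_of_nonpos_of_nonneg hN (by positivity)) hχ
  · push Not at hN
    calc (((P.rootEval t).1 : ℤ) : ℝ) / (2 ^ 30 * (2 * ((piUpQ : ℚ) : ℝ)) ^ 2)
        = ((((P.rootEval t).1 : ℤ) : ℝ) / 2 ^ 30) / (2 * ((piUpQ : ℚ) : ℝ)) ^ 2 := by rw [div_div]
      _ ≤ ((((P.rootEval t).1 : ℤ) : ℝ) / 2 ^ 30) / (2 * π) ^ 2 := by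
          apply div_le_div_of_nonneg_left (by positivity) hpos hpi
      _ ≤ (∫ p in brillouinZone, P.integrand p) / (2 * π) ^ 2 := div_le_div_of_nonneg_right hI hpos.le

/-- CEILING GATE: from `CeilSoundAt`, a certified ceiling numerator `N` gives `χ₀ ≤ N / (2^30 (2·piLoQ)²)` (no integrability hypothesis:
the ceiling statement supplies it). [folklore] -/
theorem lindhard_le_ceil (P : Params) (t : QB) (hC : CeilSoundAt P t) (hP : P.admissible = true) (N : ℤ)
    (hN : (P.rootEval t).2 = some N) :
    P.chi ≤ ((N : ℤ) : ℝ) / (2 ^ 30 * (2 * ((piLoQ : ℚ) : ℝ)) ^ 2) := by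
  obtain ⟨_, hle⟩ := hC N hP hN
  have hpos : (0 : ℝ) < (2 * π) ^ 2 := by positivity
  have hI : (∫ p in brillouinZone, P.integrand p) ≤ ((N : ℤ) : ℝ) / 2 ^ 30 := by
    rw [le_div_iff₀ (by positivity)]; linarith
  have hN0 : (0 : ℝ) ≤ ((N : ℤ) : ℝ) / 2 ^ 30 :=
    le_trans (integral_nonneg fun p => lindhardIntegrand_nonneg _ _ _ p) hI
  unfold Params.chi lindhardFunction
  calc (∫ p in brillouinZone, P.integrand p) / (2 * π) ^ 2
      ≤ (((N : ℤ) : ℝ) / 2 ^ 30) / (2 * π) ^ 2 := div_le_div_of_nonneg_right hI hpos.le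
    _ ≤ (((N : ℤ) : ℝ) / 2 ^ 30) / (2 * ((piLoQ : ℚ) : ℝ)) ^ 2 :=
        div_le_div_of_nonneg_left hN0 twoPiLo_sq_pos le_twoPi_sq
    _ = ((N : ℤ) : ℝ) / (2 ^ 30 * (2 * ((piLoQ : ℚ) : ℝ)) ^ 2) := by rw [div_div]

/-- **TWO-SIDED KERNEL ENCLOSURE** (modulo the two named statements): if the kernel evaluates the certificate to `(Nf, some Nc)` then
`Nf/(2^30 (2·piUpQ)²) ≤ χ₀(q; μ, t′) ≤ Nc/(2^30 (2·piLoQ)²)`. [folklore] -/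
theorem lindhard_mem_enclosure (P : Params) (t : QB) (hF : FloorSoundAt P t) (hC : CeilSoundAt P t) (hP : P.admissible = true)
    (Nf Nc : ℤ) (hE : P.rootEval t = (Nf, some Nc)) :
    ((Nf : ℤ) : ℝ) / (2 ^ 30 * (2 * ((piUpQ : ℚ) : ℝ)) ^ 2) ≤ P.chi ∧ P.chi ≤ ((Nc : ℤ) : ℝ) / (2 ^ 30 * (2 * ((piLoQ : ℚ) : ℝ)) ^ 2) := by
  have h1 : (P.rootEval t).1 = Nf := by rw [hE]
  have h2 : (P.rootEval t).2 = some Nc := by rw [hE]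
  obtain ⟨hint, _⟩ := hC Nc hP h2
  exact ⟨by simpa [h1] using floor_le_lindhard P t hF hP hint, lindhard_le_ceil P t hC hP Nc h2⟩

/-- **CONTAINMENT GATE («engine hull ⊇ kernel enclosure»)**: a hull row `[lo, hi]` claimed for a box containing the certificate's rational point
`(q; μ, t′)` is CONFIRMED at that point by the kernel if `lo · 2^30 (2·piUpQ)² ≤ Nf` and `Nc ≤ hi · 2^30 (2·piLoQ)²` — then
`lo ≤ χ₀ ≤ hi` (modulo the two named statements). [folklore] -/
theorem hull_contains (P : Params) (t : QB) (hF : FloorSoundAt P t) (hC : CeilSoundAt P t) (hP : P.admissible = true)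
    (Nf Nc : ℤ) (hE : P.rootEval t = (Nf, some Nc)) (lo hi : ℚ)
    (hlo : lo * (2 ^ 30 * (2 * piUpQ) ^ 2) ≤ Nf) (hhi : (Nc : ℚ) ≤ hi * (2 ^ 30 * (2 * piLoQ) ^ 2)) :
    ((lo : ℚ) : ℝ) ≤ P.chi ∧ P.chi ≤ ((hi : ℚ) : ℝ) := by
  obtain ⟨h1, h2⟩ := lindhard_mem_enclosure P t hF hC hP Nf Nc hE
  have hposU : (0 : ℝ) < 2 ^ 30 * (2 * ((piUpQ : ℚ) : ℝ)) ^ 2 := by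
    have := pi_lt_piUpQ; have : (0:ℝ) < ((piUpQ : ℚ) : ℝ) := lt_trans pi_pos this; positivity
  have hposL : (0 : ℝ) < 2 ^ 30 * (2 * ((piLoQ : ℚ) : ℝ)) ^ 2 := by have := twoPiLo_sq_pos; positivity
  constructor
  · have hlo' : ((lo : ℚ) : ℝ) * (2 ^ 30 * (2 * ((piUpQ : ℚ) : ℝ)) ^ 2) ≤ ((Nf : ℤ) : ℝ) := by
      have := (Rat.cast_le (K := ℝ)).2 hlo; push_cast at this; linarith
    have : ((lo : ℚ) : ℝ) ≤ ((Nf : ℤ) : ℝ) / (2 ^ 30 * (2 * ((piUpQ : ℚ) : ℝ)) ^ 2) := by rw [le_div_iff₀ hposU]; exact hlo'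
    linarith
  · have hhi' : ((Nc : ℤ) : ℝ) ≤ ((hi : ℚ) : ℝ) * (2 ^ 30 * (2 * ((piLoQ : ℚ) : ℝ)) ^ 2) := by
      have := (Rat.cast_le (K := ℝ)).2 hhi; push_cast at this; linarith
    have : ((Nc : ℤ) : ℝ) / (2 ^ 30 * (2 * ((piLoQ : ℚ) : ℝ)) ^ 2) ≤ ((hi : ℚ) : ℝ) := by rw [div_le_iff₀ hposL]; exact hhi'
    linarith

/-- EXCLUSION GATE FROM BELOW (round 10, Bochner dichotomy — no integrability needed): `hi · 2^30 (2·piUpQ)² < Nf` and `0 < lo` refute the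
row `[lo, hi]` at the point. [folklore] -/
theorem hull_excluded_below (P : Params) (t : QB) (hF : FloorSoundAt P t) (hP : P.admissible = true) (lo hi : ℚ) (hlo : 0 < lo)
    (hhi : hi * (2 ^ 30 * (2 * piUpQ) ^ 2) < (P.rootEval t).1) :
    ¬ (((lo : ℚ) : ℝ) ≤ P.chi ∧ P.chi ≤ ((hi : ℚ) : ℝ)) := by
  rintro ⟨h1, h2⟩
  by_cases hint : IntegrableOn P.integrand brillouinZone volume
  · have hf := floor_le_lindhard P t hF hP hint
    have hhi' : ((hi : ℚ) : ℝ) * (2 ^ 30 * (2 * ((piUpQ : ℚ) : ℝ)) ^ 2) < (((P.rootEval t).1 : ℤ) : ℝ) := by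
      have := (Rat.cast_lt (K := ℝ)).2 hhi; push_cast at this; linarith
    have hpos : (0 : ℝ) < 2 ^ 30 * (2 * ((piUpQ : ℚ) : ℝ)) ^ 2 := by
      have := pi_lt_piUpQ; have : (0:ℝ) < ((piUpQ : ℚ) : ℝ) := lt_trans pi_pos this; positivity
    have : ((hi : ℚ) : ℝ) < (((P.rootEval t).1 : ℤ) : ℝ) / (2 ^ 30 * (2 * ((piUpQ : ℚ) : ℝ)) ^ 2) := by
      rw [lt_div_iff₀ hpos]; exact hhi'
    linarith
  · have h0 : P.chi = 0 := by
      unfold Params.chi lindhardFunction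
      rw [show (∫ p in brillouinZone, lindhardIntegrand P.band ((P.mu : ℚ) : ℝ) P.qv p) = 0 from integral_undef hint, zero_div]
    have : (0 : ℝ) < ((lo : ℚ) : ℝ) := by exact_mod_cast hlo
    linarith

/-- EXCLUSION GATE FROM ABOVE (new): a certified ceiling `Nc < lo · 2^30 (2·piLoQ)²` refutes the row `[lo, hi]` at the point. [folklore] -/
theorem hull_excluded_above (P : Params) (t : QB) (hC : CeilSoundAt P t) (hP : P.admissible = true) (lo hi : ℚ) (N : ℤ)
    (hN : (P.rootEval t).2 = some N) (hlo : (N : ℚ) < lo * (2 ^ 30 * (2 * piLoQ) ^ 2)) :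
    ¬ (((lo : ℚ) : ℝ) ≤ P.chi ∧ P.chi ≤ ((hi : ℚ) : ℝ)) := by
  rintro ⟨h1, _⟩
  have hc := lindhard_le_ceil P t hC hP N hN
  have hposL : (0 : ℝ) < 2 ^ 30 * (2 * ((piLoQ : ℚ) : ℝ)) ^ 2 := by have := twoPiLo_sq_pos; positivity
  have hlo' : ((N : ℤ) : ℝ) < ((lo : ℚ) : ℝ) * (2 ^ 30 * (2 * ((piLoQ : ℚ) : ℝ)) ^ 2) := by
    have := (Rat.cast_lt (K := ℝ)).2 hlo; push_cast at this; linarith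
  have : ((N : ℤ) : ℝ) / (2 ^ 30 * (2 * ((piLoQ : ℚ) : ℝ)) ^ 2) < ((lo : ℚ) : ℝ) := by rw [div_lt_iff₀ hposL]; exact hlo'
  linarith

/-! ## §5 Analytic anchors of the ceiling rules (proved) -/

/-- `S(a) = 2 + 4t′a`. [folklore] -/
def slopeS (tp a : ℝ) : ℝ := 2 + 4 * tp * a

/-- `b⋆(a) = −(2a + μ)/(2 + 4t′a)`: the Fermi curve `{ε = μ}` as an explicit graph in cosine coordinates. [folklore] -/
def bStar (tp μ a : ℝ) : ℝ := -(2 * a + μ) / slopeS tp a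

/-- The band is affine in the second cosine: `ε(a, b) = −2a − S(a)·b`. [folklore] -/
theorem band_affine_in_b (tp a b : ℝ) : bandR tp a b = -2 * a - slopeS tp a * b := by
  unfold bandR slopeS; ring

/-- The band is symmetric in the two cosines (so `a⋆ = b⋆` as functions: the `a`-substitution variant of the hyperbola rule). [folklore] -/
theorem band_symm (tp a b : ℝ) : bandR tp a b = bandR tp b a := by
  unfold bandR; ring

/-- `0 < S(a)` for `|t′| < 1/2`, `|a| ≤ 1`. [folklore] -/
theorem slopeS_pos {tp a : ℝ} (htp : |tp| < 1 / 2) (ha : |a| ≤ 1) : 0 < slopeS tp a := by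
  unfold slopeS
  have h1 : |tp * a| ≤ |tp| := by
    rw [abs_mul]; exact mul_le_of_le_one_right (abs_nonneg _) ha
  have h2 : -(1 / 2) < tp * a := by
    have := neg_abs_le (tp * a); linarith
  linarith

/-- Occupied iff above the hyperbola: for `0 < S(a)`, `ε(a, b) < μ ↔ b⋆(a) < b`. [folklore] -/
theorem band_lt_iff_bStar_lt {tp μ a b : ℝ} (hS : 0 < slopeS tp a) : bandR tp a b < μ ↔ bStar tp μ a < b := by
  rw [band_affine_in_b, bStar, div_lt_iff₀ hS]
  constructor <;> intro h <;> nlinarith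

/-- The distance to the level in cosine coordinates: `μ − ε(a,b) = S(a)·(b − b⋆(a))`. [folklore] -/
theorem mu_sub_band_eq {tp μ a b : ℝ} (hS : 0 < slopeS tp a) : μ - bandR tp a b = slopeS tp a * (b - bStar tp μ a) := by
  rw [band_affine_in_b, bStar]
  field_simp
  ring

/-- The `b`-integral kernel of the majorised hyperbola rule is ANTITONE in the slope: for `0 < S ≤ S'`, `0 ≤ L`, `0 < V`,
`log(1 + S' L/V)/S' ≤ log(1 + S L/V)/S` — equivalently `φ(x) = log(1 + x)/x` is antitone on `(0, ∞)`; here in the product form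
`S · log(1 + S' c) ≤ S' · log(1 + S c)` that the soundness proof uses (`c = L/V ≥ 0`). [folklore] -/
theorem slope_log_antitone {S S' c : ℝ} (hS : 0 < S) (hSS' : S ≤ S') (hc : 0 ≤ c) :
    S * Real.log (1 + S' * c) ≤ S' * Real.log (1 + S * c) := by
  -- concavity of `log (1 + ·)` at `0`: `log(1 + S'c) = log(1 + (S'/S)·(S c))` and `log(1 + λ u) ≤ λ log(1 + u)` for `λ ≥ 1`, `u ≥ 0`
  have hS' : 0 < S' := lt_of_lt_of_le hS hSS'
  have hu : 0 ≤ S * c := mul_nonneg hS.le hc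
  set u := S * c with hu_def
  set l := S' / S with hl_def
  have hl : 1 ≤ l := by rw [hl_def, le_div_iff₀ hS]; linarith
  have key : Real.log (1 + l * u) ≤ l * Real.log (1 + u) := by
    -- `t ↦ log(1+t)` is concave with value 0 at 0, so `log(1 + l u)/ (l u) ≤ log(1+u)/u`; via the secant inequality of `ConcaveOn`.
    have hcv : ConcaveOn ℝ (Set.Ici (0:ℝ)) (fun t => Real.log (1 + t)) := by
      have h1 : ConcaveOn ℝ (Set.Ioi (0:ℝ)) Real.log := strictConcaveOn_log_Ioi.concaveOn
      have h2 : ConcaveOn ℝ (Set.Ici (0:ℝ)) (fun t => Real.log (1 + t)) := by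
        refine ⟨convex_Ici 0, ?_⟩
        intro x hx y hy a b ha hb hab
        have hx' : (0:ℝ) < 1 + x := by simp only [Set.mem_Ici] at hx; linarith
        have hy' : (0:ℝ) < 1 + y := by simp only [Set.mem_Ici] at hy; linarith
        have := h1.2 hx' hy' ha hb hab
        simp only [smul_eq_mul] at this ⊢
        have heq : a * (1 + x) + b * (1 + y) = 1 + (a * x + b * y) := by linear_combination hab
        rw [heq] at this
        exact this
      exact h2
    -- apply concavity between 0 and l*u at the point u = (1/l)(l u) + (1 - 1/l) 0
    have hlpos : 0 < l := by linarith
    have hmem0 : (0:ℝ) ∈ Set.Ici (0:ℝ) := by simp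
    have hmem1 : l * u ∈ Set.Ici (0:ℝ) := by simp; positivity
    have ha : 0 ≤ 1 - 1 / l := by rw [sub_nonneg, div_le_one hlpos]; exact hl
    have hb : 0 ≤ 1 / l := by positivity
    have := hcv.2 hmem0 hmem1 ha hb (by ring)
    simp only [smul_eq_mul, mul_zero, add_zero, Real.log_one, zero_add] at this
    have hsimp : (1 / l) * (l * u) = u := by field_simp
    rw [hsimp] at this
    -- this : (1/l) * log(1 + l u) ≤ log (1 + u)
    have := mul_le_mul_of_nonneg_left this hlpos.le
    have hsimp2 : l * (1 / l * Real.log (1 + l * u)) = Real.log (1 + l * u) := by field_simp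
    rw [hsimp2] at this
    exact this
  have hlu : l * u = S' * c := by rw [hl_def, hu_def]; field_simp
  rw [hlu] at key
  have := mul_le_mul_of_nonneg_left key hS.le
  calc S * Real.log (1 + S' * c) ≤ S * (l * Real.log (1 + u)) := this
    _ = S' * Real.log (1 + S * c) := by rw [hl_def, hu_def]; field_simp

/-- **The `[2,1]` Padé LOG MAJORANT**: `log(1 + z) ≤ z(z + 6)/(2(2z + 3))` for `z ≥ 0` (the defect `h(z) = RHS − log(1+z)` has `h(0) = 0` and
`h′(z) = z³/((2z+3)²(1+z)) ≥ 0`). This is the rational majorant inside `logUpZ`. [folklore] -/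
theorem log_le_pade {z : ℝ} (hz : 0 ≤ z) : Real.log (1 + z) ≤ z * (z + 6) / (2 * (2 * z + 3)) := by
  -- monotonicity of the defect `h` on `[0, ∞)`
  let h : ℝ → ℝ := fun t => t * (t + 6) / (2 * (2 * t + 3)) - Real.log (1 + t)
  have hderiv : ∀ t : ℝ, 0 ≤ t → HasDerivAt h (t ^ 3 / ((2 * t + 3) ^ 2 * (1 + t))) t := by
    intro t ht
    have hne : (2 * (2 * t + 3)) ≠ 0 := by positivity
    have hne1 : (1 + t) ≠ 0 := by positivity
    have h1 : HasDerivAt (fun y : ℝ => y * (y + 6)) (1 * (t + 6) + t * 1) t :=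
      (hasDerivAt_id' t).mul ((hasDerivAt_id' t).add_const 6)
    have h2 : HasDerivAt (fun y : ℝ => 2 * (2 * y + 3)) (2 * (2 * 1)) t :=
      (((hasDerivAt_id' t).const_mul 2).add_const 3).const_mul 2
    have h3 : HasDerivAt (fun y : ℝ => Real.log (1 + y)) (1 / (1 + t)) t :=
      ((hasDerivAt_id' t).const_add 1).log hne1
    have hd := (h1.div h2 hne).sub h3
    have heq : ((1 * (t + 6) + t * 1) * (2 * (2 * t + 3)) - t * (t + 6) * (2 * (2 * 1))) / (2 * (2 * t + 3)) ^ 2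
        - 1 / (1 + t) = t ^ 3 / ((2 * t + 3) ^ 2 * (1 + t)) := by
      field_simp
      ring
    rw [← heq]
    exact hd
  have hmono : MonotoneOn h (Set.Ici 0) := by
    apply monotoneOn_of_hasDerivWithinAt_nonneg (f' := fun t => t ^ 3 / ((2 * t + 3) ^ 2 * (1 + t))) (convex_Ici 0)
    · exact fun t ht => (hderiv t (Set.mem_Ici.mp ht)).continuousAt.continuousWithinAt
    · intro t ht
      rw [interior_Ici] at ht
      exact (hderiv t (le_of_lt (Set.mem_Ioi.mp ht))).hasDerivWithinAt
    · intro t ht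
      rw [interior_Ici] at ht
      have : (0:ℝ) < t := Set.mem_Ioi.mp ht
      positivity
  have h0 : h 0 = 0 := by simp [h]
  have := hmono (Set.mem_Ici.mpr (le_refl (0:ℝ))) (Set.mem_Ici.mpr hz) hz
  rw [h0] at this
  change (0:ℝ) ≤ z * (z + 6) / (2 * (2 * z + 3)) - Real.log (1 + z) at this
  linarith

/-- **TIP SLICE INEQUALITY** (the pointwise heart of the tip rule): with `a⋆, w, c ≥ 0`, `λ ≥ 0` — `|e₁| = a⋆ + w` along the monotone slice,
`|e₂| ≥ c − λw` by the Lipschitz comparison — one has `(a⋆ + w + c)/(1 + λ) ≤ a⋆ + w + max 0 (c − λ w)`, i.e.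
`1/(|e₁| + |e₂|) ≤ (1+λ)/(|e₁| + c)`. [folklore] -/
theorem tip_slice_ineq {a w c l : ℝ} (ha : 0 ≤ a) (hl : 0 ≤ l) :
    (a + w + c) / (1 + l) ≤ a + w + max 0 (c - l * w) := by
  rw [div_le_iff₀ (by linarith)]
  rcases le_total 0 (c - l * w) with h | h
  · rw [max_eq_right h]; nlinarith [mul_nonneg hl ha]
  · rw [max_eq_left h]; nlinarith [mul_nonneg hl ha]

/-- **MEAN-VALUE MATRIX BOUND** (the conditioning step of the tip rule), `2 × 2` case: if `|det A| ≥ J` and every entry `|A_ij| ≤ L` then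
`J · max(|v₁|, |v₂|) ≤ L · (|(Av)₁| + |(Av)₂|)`. [folklore] -/
theorem mv_matrix_bound {a b c d v1 v2 J L : ℝ} (hJ : J ≤ |a * d - b * c|) (ha : |a| ≤ L) (hb : |b| ≤ L) (hc : |c| ≤ L)
    (hd : |d| ≤ L) :
    J * max |v1| |v2| ≤ L * (|a * v1 + b * v2| + |c * v1 + d * v2|) := by
  -- Cramer: det·v1 = d·(Av)₁ − b·(Av)₂, det·v2 = −c·(Av)₁ + a·(Av)₂
  set w1 := a * v1 + b * v2
  set w2 := c * v1 + d * v2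
  have e1 : (a * d - b * c) * v1 = d * w1 - b * w2 := by simp only [w1, w2]; ring
  have e2 : (a * d - b * c) * v2 = -c * w1 + a * w2 := by simp only [w1, w2]; ring
  have hL : 0 ≤ L := le_trans (abs_nonneg _) ha
  have k1 : |a * d - b * c| * |v1| ≤ L * (|w1| + |w2|) := by
    rw [← abs_mul, e1]
    calc |d * w1 - b * w2| ≤ |d * w1| + |b * w2| := abs_sub _ _
      _ = |d| * |w1| + |b| * |w2| := by rw [abs_mul, abs_mul]
      _ ≤ L * |w1| + L * |w2| := by gcongr
      _ = L * (|w1| + |w2|) := by ring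
  have k2 : |a * d - b * c| * |v2| ≤ L * (|w1| + |w2|) := by
    rw [← abs_mul, e2]
    calc |-c * w1 + a * w2| ≤ |-c * w1| + |a * w2| := abs_add_le _ _
      _ = |c| * |w1| + |a| * |w2| := by rw [abs_mul, abs_mul, abs_neg]
      _ ≤ L * |w1| + L * |w2| := by gcongr
      _ = L * (|w1| + |w2|) := by ring
  have hJ0 : J * max |v1| |v2| ≤ |a * d - b * c| * max |v1| |v2| :=
    mul_le_mul_of_nonneg_right hJ (le_trans (abs_nonneg v1) (le_max_left _ _))
  refine le_trans hJ0 ?_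
  rcases le_total |v1| |v2| with h | h
  · rw [max_eq_right h]; exact k2
  · rw [max_eq_left h]; exact k1

end Summit.HubbardSuperconductivity.HubbardSuperconductivity.Theorems.KlLindhardEnclosure

end
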